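import Summits.BirchSwinnertonDyer.BirchSwinnertonDyer.Theorems.SchneiderFreeAdditiveX3PoitouTateShaDualityHolds
import Summits.BirchSwinnertonDyer.BirchSwinnertonDyer.Theorems.SchneiderFreeAdditiveX3PoitouTateSelmerDualityHolds
import Summits.BirchSwinnertonDyer.BirchSwinnertonDyer.Theses.SchneiderFreeAdditiveX3
import Literature.NumberTheory.EllipticCurves.AnticyclotomicPrimeDecompositionSplitProofs
import Literature.NumberTheory.EllipticCurves.AnticyclotomicPrimeDecompositionAboveProofs
import HarnessLib

/-!
# The facts binder `ControlFacts` (route `SchneiderFreeAdditiveX3`, item stmt-BirchSwinnertonDyer-19538) — PROVED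

Cell `bsd-schneider-ideate`, seat `bsd-schneider-door-c4` (prover, generation 19).  PARTITION: board row B6 ∩ X3 ∩ sst-twist,
`r = 1`, of `Rank1Residual.partition` — CONTROL corner; this file CLOSES the facts-binder support item 19538 on the leaf path of
rung K1-door (a LEAF, never the summit).  bears_on: K1-door (r1, B6∩X3-sst) (route-BirchSwinnertonDyer-SchneiderFreeAdditiveX3
items 18969 → 19295; 19538).

`ControlFacts` = (i) `∀ K, poitouTate_selmerStructure_duality K` ∧ (ii) `∀ K, poitouTate_sha_tateDual K` ∧ (iii) `∀ K p,
ZpExtension.decomp_not_le_kerSubgroup_of_isAnticyclotomic K p` (Brink 2007 Thm. 2) ∧ (iv) `∀ K p,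
ZpExtension.decomp_not_le_kerSubgroup_above_of_isAnticyclotomic K p` (Brink 2007 Cor. 1) — four named facts, filed as a binder that
«closes only by formalisation».  ALL FOUR ARE NOW TREE THEOREMS: (i) `PoitouTateReduction.poitouTate_selmerStructure_duality_holds`
(door-c4 g18), (ii) `PoitouTateReduction.poitouTate_sha_tateDual_holds` (door-c4 g19), (iii)/(iv)
`ZpExtension.decomp_not_le_kerSubgroup_of_isAnticyclotomic_holds` / `…_above_of_isAnticyclotomic_holds` (Literature).

HONEST FRAMING: unconditional (std axioms); four published theorems re-proved in the tree; BSD is NOT proved by this.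
References: [MilneADT2006] I Thm. 4.10 (a),(b); [Harari2020] Thm. 17.13; [Brink2007] Thm. 2, Cor. 1.
-/

noncomputable section

-- `Summit.<P>.<Sub>` repeats `BirchSwinnertonDyer` by the tree's layout convention (D-0017)
set_option linter.dupNamespace false

namespace Summit.BirchSwinnertonDyer.BirchSwinnertonDyer.Theorems.SchneiderFreeAdditiveX3

open Summit.BirchSwinnertonDyer.BirchSwinnertonDyer.Theorems.SchneiderFreeAdditiveX3.PoitouTateReduction
  (poitouTate_selmerStructure_duality_holds poitouTate_sha_tateDual_holds)
open Literature.NumberTheory.EllipticCurves.ZpExtension (decomp_not_le_kerSubgroup_of_isAnticyclotomic_holds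
  decomp_not_le_kerSubgroup_above_of_isAnticyclotomic_holds)

/-- **The facts binder `ControlFacts` (item stmt-BirchSwinnertonDyer-19538), proved**: Poitou–Tate duality for Selmer
structures (i) and for `Ш` (ii) at every number field, Brink 2007 Thm. 2 (iii) and Cor. 1 (iv) — each conjunct a tree theorem.
Unconditional; BSD is not proved by this.
[cite: MilneADT2006, Ch. I, Thm. 4.10 (a),(b)][cite: Harari2020, Thm. 17.13][cite: Brink2007, Thm. 2 and Cor. 1] -/
theorem controlFacts_proof :
    Summit.BirchSwinnertonDyer.BirchSwinnertonDyer.Theses.SchneiderFreeAdditiveX3.ControlFacts :=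
  ⟨fun K _ _ => poitouTate_selmerStructure_duality_holds K, fun K _ _ => poitouTate_sha_tateDual_holds K,
    fun K _ _ p _ => decomp_not_le_kerSubgroup_of_isAnticyclotomic_holds K p,
    fun K _ _ p _ => decomp_not_le_kerSubgroup_above_of_isAnticyclotomic_holds K p⟩

end Summit.BirchSwinnertonDyer.BirchSwinnertonDyer.Theorems.SchneiderFreeAdditiveX3

end
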